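import Summits.Ventures.PercRepro.OrthoSpan

/-!
# PercRepro — the sign vectors of 4-subsets of `[8]` and the (D) inequality for colour classes (typer-2, gen 5)

The glue between `OrthoSpan.lean` (piece (D): three mutually orthogonal subspaces of `𝟙^⊥ ⊂ ℝ⁸` have
dimension sum `≤ 7`) and p4's code: a subset `σ ⊆ Fin 8` has the **sign vector** `x_σ = +1` on `σ`, `−1` off `σ`
(`signVec`), with `⟪x_σ, x_τ⟫ = 4·|σ ∩ τ| − 2·|σ| − 2·|τ| + 8` (`inner_signVec`), so for 4-sets
`⟪x_σ, x_τ⟫ = 4·|σ ∩ τ| − 8`: balanced vectors lie in `𝟙^⊥` (`signVec_mem_orthogonal_ones`) and two 4-sets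
meeting in exactly two points have orthogonal sign vectors (`inner_signVec_eq_zero_of_inter_two`). Hence for three
families `X, Y, Z` of 4-subsets whose cross-family meets all have size `2` — in p4's code (`CodeBound8`) these are
the oriented representatives of the three bipartition TYPES `AB, AC, BC` (§9.1 (i): for bipartitions of different
types both cross-intersections are `≤ 2` and sum to `4`, so both are `2`) — the spans `U_X, U_Y, U_Z` are mutually
orthogonal inside `𝟙^⊥` and **`finrank U_X + finrank U_Y + finrank U_Z ≤ 7`**
(`finrank_span_signVec_add_three_le_seven`). Deriving the two hypotheses from the code axioms is p4's (iv).
-/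

namespace PercRepro

open Module Submodule Finset

/-- The sign vector of `σ ⊆ Fin 8`: `+1` on `σ`, `−1` off `σ`. -/
noncomputable def signVec (σ : Finset (Fin 8)) : EuclideanSpace ℝ (Fin 8) :=
  (WithLp.equiv 2 (Fin 8 → ℝ)).symm fun i => if i ∈ σ then 1 else -1

/-- The coordinates of a sign vector. -/
theorem signVec_apply (σ : Finset (Fin 8)) (i : Fin 8) : signVec σ i = if i ∈ σ then 1 else -1 := rfl

/-- The coordinates of the all-ones vector. -/
theorem ones8_apply (i : Fin 8) : ones8 i = 1 := rfl

/-- `±1` as `2·[i ∈ σ] − 1`. -/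
theorem signVec_apply_eq (σ : Finset (Fin 8)) (i : Fin 8) :
    signVec σ i = 2 * (if i ∈ σ then (1 : ℝ) else 0) - 1 := by
  rw [signVec_apply]
  split_ifs <;> norm_num

/-- **The Gram entry of two sign vectors**: `⟪x_σ, x_τ⟫ = 4·|σ ∩ τ| − 2·|σ| − 2·|τ| + 8`. -/
theorem inner_signVec (σ τ : Finset (Fin 8)) :
    inner ℝ (signVec σ) (signVec τ) = 4 * (σ ∩ τ).card - 2 * σ.card - 2 * τ.card + 8 := by
  rw [PiLp.inner_apply]
  simp only [signVec_apply_eq, RCLike.inner_apply, conj_trivial]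
  have hσ : (σ.card : ℝ) = ∑ i : Fin 8, if i ∈ σ then (1 : ℝ) else 0 := by
    rw [Finset.sum_boole, Finset.filter_mem_eq_inter, Finset.univ_inter]
  have hτ : (τ.card : ℝ) = ∑ i : Fin 8, if i ∈ τ then (1 : ℝ) else 0 := by
    rw [Finset.sum_boole, Finset.filter_mem_eq_inter, Finset.univ_inter]
  have hστ : ((σ ∩ τ).card : ℝ) =
      ∑ i : Fin 8, (if i ∈ σ then (1 : ℝ) else 0) * (if i ∈ τ then (1 : ℝ) else 0) := by
    rw [Finset.card_eq_sum_ones, Nat.cast_sum]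
    rw [← Finset.sum_filter_add_sum_filter_not Finset.univ (fun i => i ∈ σ ∩ τ)]
    simp only [Finset.filter_mem_eq_inter, Finset.univ_inter, Nat.cast_one]
    have h1 : ∀ i ∈ σ ∩ τ, (if i ∈ σ then (1 : ℝ) else 0) * (if i ∈ τ then (1 : ℝ) else 0) = 1 := by
      intro i hi
      rw [Finset.mem_inter] at hi
      simp [hi.1, hi.2]
    have h2 : ∀ i ∈ Finset.univ.filter (fun i => ¬ i ∈ σ ∩ τ),
        (if i ∈ σ then (1 : ℝ) else 0) * (if i ∈ τ then (1 : ℝ) else 0) = 0 := by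
      intro i hi
      rw [Finset.mem_filter, Finset.mem_inter] at hi
      by_cases h1 : i ∈ σ <;> by_cases h2 : i ∈ τ <;> simp [h1, h2] at hi ⊢
    rw [Finset.sum_congr rfl h1, Finset.sum_congr rfl h2, Finset.sum_const_zero, add_zero,
      Finset.sum_const, nsmul_eq_mul, mul_one]
  have hsum : ∑ i : Fin 8, (2 * (if i ∈ τ then (1 : ℝ) else 0) - 1) *
      (2 * (if i ∈ σ then (1 : ℝ) else 0) - 1) =
      4 * (∑ i : Fin 8, (if i ∈ σ then (1 : ℝ) else 0) * (if i ∈ τ then (1 : ℝ) else 0)) -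
        2 * (∑ i : Fin 8, if i ∈ σ then (1 : ℝ) else 0) -
        2 * (∑ i : Fin 8, if i ∈ τ then (1 : ℝ) else 0) + 8 := by
    simp only [Finset.mul_sum, ← Finset.sum_sub_distrib]
    rw [show (8 : ℝ) = ∑ _i : Fin 8, (1 : ℝ) by simp, ← Finset.sum_add_distrib]
    refine Finset.sum_congr rfl fun i _ => ?_
    ring
  rw [hσ, hτ, hστ, ← hsum]

/-- A 4-subset's sign vector is orthogonal to `𝟙`. -/
theorem inner_ones8_signVec (σ : Finset (Fin 8)) (hσ : σ.card = 4) :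
    inner ℝ ones8 (signVec σ) = 0 := by
  rw [PiLp.inner_apply]
  simp only [ones8_apply, signVec_apply_eq, RCLike.inner_apply, conj_trivial, mul_one]
  rw [Finset.sum_sub_distrib, ← Finset.mul_sum, Finset.sum_boole, Finset.filter_mem_eq_inter,
    Finset.univ_inter, hσ]
  norm_num [Finset.sum_const]

/-- Balanced sign vectors lie in the hyperplane `𝟙^⊥`. -/
theorem signVec_mem_orthogonal_ones (σ : Finset (Fin 8)) (hσ : σ.card = 4) :
    signVec σ ∈ (ℝ ∙ ones8)ᗮ :=
  Submodule.mem_orthogonal_singleton_iff_inner_right.mpr (inner_ones8_signVec σ hσ)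

/-- Two 4-sets meeting in exactly two points have orthogonal sign vectors. -/
theorem inner_signVec_eq_zero_of_inter_two (σ τ : Finset (Fin 8)) (hσ : σ.card = 4) (hτ : τ.card = 4)
    (h : (σ ∩ τ).card = 2) : inner ℝ (signVec σ) (signVec τ) = 0 := by
  rw [inner_signVec, hσ, hτ, h]
  norm_num

/-- The span of the sign vectors of a family of 4-sets lies in `𝟙^⊥`. -/
theorem span_signVec_le_orthogonal_ones (X : Finset (Finset (Fin 8))) (hX : ∀ σ ∈ X, σ.card = 4) :
    span ℝ (signVec '' (X : Set (Finset (Fin 8)))) ≤ (ℝ ∙ ones8)ᗮ := by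
  rw [Submodule.span_le]
  rintro _ ⟨σ, hσ, rfl⟩
  exact signVec_mem_orthogonal_ones σ (hX σ hσ)

/-- Two families of 4-sets whose cross meets all have size `2` span orthogonal subspaces. -/
theorem isOrtho_span_signVec (X Y : Finset (Finset (Fin 8))) (hX : ∀ σ ∈ X, σ.card = 4)
    (hY : ∀ τ ∈ Y, τ.card = 4) (hXY : ∀ σ ∈ X, ∀ τ ∈ Y, (σ ∩ τ).card = 2) :
    span ℝ (signVec '' (X : Set (Finset (Fin 8)))) ⟂ span ℝ (signVec '' (Y : Set (Finset (Fin 8)))) := by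
  rw [Submodule.isOrtho_span]
  rintro _ ⟨σ, hσ, rfl⟩ _ ⟨τ, hτ, rfl⟩
  exact inner_signVec_eq_zero_of_inter_two σ τ (hX σ hσ) (hY τ hτ) (hXY σ hσ τ hτ)

/-- **Piece (D) for three colour classes of 4-sets**: if every cross-class meet has size `2`, the spans of
the three classes' sign vectors have dimension sum `≤ 7`. -/
theorem finrank_span_signVec_add_three_le_seven (X Y Z : Finset (Finset (Fin 8)))
    (hX : ∀ σ ∈ X, σ.card = 4) (hY : ∀ σ ∈ Y, σ.card = 4) (hZ : ∀ σ ∈ Z, σ.card = 4)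
    (hXY : ∀ σ ∈ X, ∀ τ ∈ Y, (σ ∩ τ).card = 2) (hXZ : ∀ σ ∈ X, ∀ τ ∈ Z, (σ ∩ τ).card = 2)
    (hYZ : ∀ σ ∈ Y, ∀ τ ∈ Z, (σ ∩ τ).card = 2) :
    finrank ℝ (span ℝ (signVec '' (X : Set (Finset (Fin 8))))) +
        finrank ℝ (span ℝ (signVec '' (Y : Set (Finset (Fin 8))))) +
        finrank ℝ (span ℝ (signVec '' (Z : Set (Finset (Fin 8))))) ≤ 7 :=
  finrank_add_three_le_seven _ _ _ (isOrtho_span_signVec X Y hX hY hXY) (isOrtho_span_signVec X Z hX hZ hXZ)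
    (isOrtho_span_signVec Y Z hY hZ hYZ) (span_signVec_le_orthogonal_ones X hX)
    (span_signVec_le_orthogonal_ones Y hY) (span_signVec_le_orthogonal_ones Z hZ)

end PercRepro
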